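import Summits.BirchSwinnertonDyer.BirchSwinnertonDyer.Theorems.PrintCf2SplitBadTwoTamagawaSevenDvd
import Summits.BirchSwinnertonDyer.BirchSwinnertonDyer.Theorems.GoldfeldAllTwistsTwoConverseTwinAdditiveTorsion
import HarnessLib

/-!
# Crux `PrintCf2.SplitBadTwoRankOneOfFacts` (stmt-BirchSwinnertonDyer-20368), road α v10.3 (stub S3c) — brick B16-TAM-7, file 1b:
# `#W(ℚ)_tors = 2` for every model `W` of `cm7^{(d)}` with `7 ∣ d` (`d` squarefree, `d ≢ 1 (mod 4)`)

Cell `bsd-print-cf2`, width seat `bsd-line-cf2-p1-w3` g8 (prover-bsd-line-cf2-p1-w3-g8-0). `--supports stmt-BirchSwinnertonDyer-20368`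
(helper, Theses-free). HONEST FRAMING: nothing here closes the crux or a registered stub; BSD is not proved by any of this; no summit
statement is proved by this seat. No definition, no named fact, no `sorry`.

WHY. S3c's right-hand side carries `padicValNat 2 W.torsionOrder`; LEAD g12's cut 4 (`restrictedControl_two_of_residuals_split_places`,
hypothesis (R-SEVEN)) needs `W.torsionOrder = 2` for the members with `7 ∣ d`, which bsd-goldfeld c301's
`GoldfeldGoodTwists.torsionOrder_eq_two_of_smul_eq_cm7_quadraticTwist` excludes (`7 ∤ d`). c301's Dirichlet-free proof goes through
`[X(ℚ₇) : X₁(ℚ₇)] = c₇·7 = 14`, using `c₇ = 2` at `7 ∤ d` (type `III`); for `7 ∣ d` the SAME `c₇ = 2` holds (type `III*`, this seat's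
`TamagawaPlaces.localTamagawaNumber_padic_cellTwist_seven_of_dvd`, p664173), so the proof goes through VERBATIM with that one lemma swapped:
`two_nsmul_eq_zero_of_isOfFinAddOrder_cellTwist_of_dvd`, `torsionOrder_cellTwist_of_dvd`, **`torsionOrder_eq_two_of_smul_eq_cm7_quadraticTwist_of_dvd`**,
and the hypothesis-free union **`torsionOrder_eq_two_of_smul_eq_cm7_quadraticTwist'`** (every squarefree `d ≢ 1 (mod 4)`).
presearch: Olson 1974 (torsion of CM curves over `ℚ`: `j = −3375 ⇒ ℤ/2`), Silverman AEC VII.3 — held; tree: c301's file VI reused BY NAME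
(`nsmul_eq_zero_of_local`, `nsmul_mem_formalFiltration_one`, `natCard_torsionBy_two_cellTwist`, `additive_two_seven_cellTwist`). No fact filed.
beyond-print theorem: no.

References: [SilvermanAEC2009] VII.2.1, VII.3.1, VIII.7; [Silverman1994] IV.9 Table 4.1; [Olson1974] Thm. 1.
-/

noncomputable section

open scoped Classical NumberField

set_option linter.dupNamespace false
set_option autoImplicit false

open WeierstrassCurve IsDedekindDomain IsLocalRing Rat.HeightOneSpectrum
  Literature.NumberTheory.EllipticCurves Literature.NumberTheory.EllipticCurves.ModularForms
  Literature.NumberTheory.QuadraticForms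
  Summit.BirchSwinnertonDyer.BirchSwinnertonDyer.Rank2Observatory.Tate
  Summit.BirchSwinnertonDyer.BirchSwinnertonDyer.Rank2Observatory.RootNumber
  Summit.BirchSwinnertonDyer.BirchSwinnertonDyer.Theorems.GoldfeldGoodTwists

namespace Summit.BirchSwinnertonDyer.BirchSwinnertonDyer.Theorems.PrintCf2.TamagawaPlaces

section Torsion

variable {d : ℤ}

/-- **`2 • T = 0` for every rational torsion point `T` of `X_d = X₀(49)^{(4d)}` when `7 ∣ d`** (`d` squarefree, `d ≢ 1 (mod 4)`): c301's argument
through the two additive primes, with `c₇ = 2` now from type `III*` (`localTamagawaNumber_padic_cellTwist_seven_of_dvd`): at `2`, `[X(ℚ₂) : X₁] = 8`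
kills the odd part of the order; at `7`, `[X(ℚ₇) : X₁] = 14` and `gcd(2^a, 14) ∣ 2` give `2T ∈ X₁(ℚ₇)`, which has no `2`-power torsion.
[cite: SilvermanAEC2009, VII.2.1, VII.3.1(a), IV.6.1] -/
theorem two_nsmul_eq_zero_of_isOfFinAddOrder_cellTwist_of_dvd (hsq : Squarefree d) (hd4 : d % 4 ≠ 1) (h7 : (7 : ℤ) ∣ d)
    (T : (haveI := cm7.isElliptic_quadraticTwist (show (((4 * d : ℤ)) : ℚ) ≠ 0 by
       have := hsq.ne_zero; exact_mod_cast (show (4 * d : ℤ) ≠ 0 by omega))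
     (cm7.quadraticTwist (((4 * d : ℤ)) : ℚ)).toAffine.Point)) (hT : IsOfFinAddOrder T) :
    (2 : ℕ) • T = 0 := by
  have hd0 : d ≠ 0 := hsq.ne_zero
  have hd : (((4 * d : ℤ)) : ℚ) ≠ 0 := by exact_mod_cast (show (4 * d : ℤ) ≠ 0 by omega)
  haveI := cm7.isElliptic_quadraticTwist hd
  haveI := isGloballyMinimal_cellTwist hsq hd4
  haveI h7p : Fact (Nat.Prime 7) := ⟨by norm_num⟩
  obtain ⟨⟨hng2, hnm2⟩, ⟨hng7, hnm7⟩⟩ := additive_two_seven_cellTwist hsq hd4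
  have hidx2 : (((cm7.quadraticTwist (((4 * d : ℤ)) : ℚ)).baseChange ℚ_[2]).formalFiltration 1).index = 8 := by
    rw [index_formalFiltration_one_of_additive _ 2 hng2 hnm2, localTamagawaNumber_padic_cellTwist_two hsq hd4]
  have hidx7 : (((cm7.quadraticTwist (((4 * d : ℤ)) : ℚ)).baseChange ℚ_[7]).formalFiltration 1).index = 14 := by
    rw [index_formalFiltration_one_of_additive _ 7 hng7 hnm7, localTamagawaNumber_padic_cellTwist_seven_of_dvd hsq h7]
  haveI : ((cm7.quadraticTwist (((4 * d : ℤ)) : ℚ)).baseChange ℚ_[2]).IsMinimal ℤ_[2] :=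
    isMinimal_map_padic_of_isGloballyMinimal _ 2
  haveI : ((cm7.quadraticTwist (((4 * d : ℤ)) : ℚ)).baseChange ℚ_[7]).IsMinimal ℤ_[7] :=
    isMinimal_map_padic_of_isGloballyMinimal _ 7
  haveI : ((cm7.quadraticTwist (((4 * d : ℤ)) : ℚ)).baseChange ℚ_[2]).IsElliptic :=
    inferInstanceAs ((cm7.quadraticTwist (((4 * d : ℤ)) : ℚ)).map (algebraMap ℚ ℚ_[2])).IsElliptic
  haveI : ((cm7.quadraticTwist (((4 * d : ℤ)) : ℚ)).baseChange ℚ_[7]).IsElliptic :=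
    inferInstanceAs ((cm7.quadraticTwist (((4 * d : ℤ)) : ℚ)).map (algebraMap ℚ ℚ_[7])).IsElliptic
  have hm0 : addOrderOf T ≠ 0 := (hT.addOrderOf_pos).ne'
  have hmT : addOrderOf T • T = 0 := addOrderOf_nsmul_eq_zero T
  obtain ⟨a, m', hm', hmeq⟩ := Nat.exists_eq_two_pow_mul_odd hm0
  set T₂ := Affine.Point.map (W' := (cm7.quadraticTwist (((4 * d : ℤ)) : ℚ)).toAffine) (S := ℚ)
    (Algebra.ofId ℚ ℚ_[2]) T with hT₂
  have hordT₂ : addOrderOf T₂ = addOrderOf T := addOrderOf_injective _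
    (Affine.Point.map_injective (W' := (cm7.quadraticTwist (((4 * d : ℤ)) : ℚ)).toAffine) (f := Algebra.ofId ℚ ℚ_[2])) T
  have hmT₂ : addOrderOf T • T₂ = 0 := by rw [← hordT₂]; exact addOrderOf_nsmul_eq_zero T₂
  have hmeq' : m' * 2 ^ a = addOrderOf T := by rw [hmeq, Nat.mul_comm]
  have hker2 : ((cm7.quadraticTwist (((4 * d : ℤ)) : ℚ)).baseChange ℚ_[2]).IsInReductionKernel ((2 ^ a) • T₂) := by
    refine nsmul_mem_formalFiltration_one _ T₂ hmT₂ hidx2 ?_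
    rw [hmeq]
    exact gcd_two_pow_mul_odd_eight_dvd hm'
  have hkill2 : m' • ((2 ^ a) • T₂) = 0 := by
    rw [← mul_nsmul', hmeq']; exact hmT₂
  have hm'2 : ¬ 2 ∣ m' := fun h ↦ (Nat.not_even_iff_odd.mpr hm') (even_iff_two_dvd.mpr h)
  have ha : (2 ^ a) • T = 0 := nsmul_eq_zero_of_local T (2 ^ a) m' hm'2 hker2 hkill2
  set T₇ := Affine.Point.map (W' := (cm7.quadraticTwist (((4 * d : ℤ)) : ℚ)).toAffine) (S := ℚ)
    (Algebra.ofId ℚ ℚ_[7]) T with hT₇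
  have hordT₇ : addOrderOf T₇ = addOrderOf T := addOrderOf_injective _
    (Affine.Point.map_injective (W' := (cm7.quadraticTwist (((4 * d : ℤ)) : ℚ)).toAffine) (f := Algebra.ofId ℚ ℚ_[7])) T
  have haT₇ : (2 ^ a) • T₇ = 0 := by
    rw [← addOrderOf_dvd_iff_nsmul_eq_zero, hordT₇]
    exact addOrderOf_dvd_of_nsmul_eq_zero ha
  have hker7 : ((cm7.quadraticTwist (((4 * d : ℤ)) : ℚ)).baseChange ℚ_[7]).IsInReductionKernel (2 • T₇) :=
    nsmul_mem_formalFiltration_one _ T₇ haT₇ hidx7 (gcd_two_pow_fourteen_dvd_two a)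
  have hkill7 : (2 ^ a) • (2 • T₇) = 0 := by
    rw [← mul_nsmul', (Nat.mul_comm (2 ^ a) 2 : 2 ^ a * 2 = 2 * 2 ^ a), mul_nsmul', haT₇, nsmul_zero]
  have h72 : ¬ 7 ∣ 2 ^ a := fun h ↦ by
    have := (Nat.Prime.dvd_of_dvd_pow (by norm_num : Nat.Prime 7) h)
    omega
  exact nsmul_eq_zero_of_local T 2 (2 ^ a) h72 hker7 hkill7

/-- **`#X_d(ℚ)_tors = 2`** for `X_d = X₀(49)^{(4d)}`, `d` squarefree, `d ≢ 1 (mod 4)`, `7 ∣ d`: every torsion point is `2`-torsion and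
`#X_d(ℚ)[2] = 2` (c301 `natCard_torsionBy_two_cellTwist`). [cite: SilvermanAEC2009, VII.3 and VIII.7] [cite: Olson1974, Thm. 1 (j = −3375)] -/
theorem torsionOrder_cellTwist_of_dvd (hsq : Squarefree d) (hd4 : d % 4 ≠ 1) (h7 : (7 : ℤ) ∣ d) :
    (haveI := cm7.isElliptic_quadraticTwist (show (((4 * d : ℤ)) : ℚ) ≠ 0 by
       have := hsq.ne_zero; exact_mod_cast (show (4 * d : ℤ) ≠ 0 by omega))
     (cm7.quadraticTwist (((4 * d : ℤ)) : ℚ)).torsionOrder) = 2 := by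
  have hd0 : d ≠ 0 := hsq.ne_zero
  have hd : (((4 * d : ℤ)) : ℚ) ≠ 0 := by exact_mod_cast (show (4 * d : ℤ) ≠ 0 by omega)
  haveI := cm7.isElliptic_quadraticTwist hd
  rw [torsionOrder_eq_natCard_torsion (cm7.quadraticTwist (((4 * d : ℤ)) : ℚ))]
  have htors : AddCommGroup.torsion (cm7.quadraticTwist (((4 * d : ℤ)) : ℚ)).toAffine.Point =
      AddSubgroup.torsionBy (cm7.quadraticTwist (((4 * d : ℤ)) : ℚ)).toAffine.Point (2 : ℤ) := by
    ext T
    rw [AddCommGroup.mem_torsion]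
    constructor
    · intro hT
      have h2 := two_nsmul_eq_zero_of_isOfFinAddOrder_cellTwist_of_dvd hsq hd4 h7 T hT
      show (2 : ℤ) • T = 0
      rw [show (2 : ℤ) = ((2 : ℕ) : ℤ) by norm_num, natCast_zsmul]
      exact h2
    · intro hT
      have h2 : (2 : ℤ) • T = 0 := hT
      rw [show (2 : ℤ) = ((2 : ℕ) : ℤ) by norm_num, natCast_zsmul] at h2
      exact isOfFinAddOrder_iff_nsmul_eq_zero.mpr ⟨2, two_pos, h2⟩
  rw [htors]
  exact natCard_torsionBy_two_cellTwist hd0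

/-- **`#W(ℚ)_tors = 2` FOR EVERY MODEL `W` of `cm7^{(d)}` with `7 ∣ d`** (`C • W = X₀(49)^{(d)}`, `d` squarefree, `d ≢ 1 (mod 4)`): `#E(ℚ)_tors` is a
`ℚ`-isomorphism invariant and `W ≅ X₀(49)^{(4d)}`. [cite: SilvermanAEC2009, VIII.7] [cite: Olson1974, Thm. 1 (j = −3375)] -/
theorem torsionOrder_eq_two_of_smul_eq_cm7_quadraticTwist_of_dvd (hsq : Squarefree d) (hd4 : d % 4 ≠ 1)
    (h7 : (7 : ℤ) ∣ d) (W : WeierstrassCurve ℚ) [W.IsElliptic] (C : VariableChange ℚ)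
    (hC : C • W = cm7.quadraticTwist (d : ℚ)) : W.torsionOrder = 2 := by
  have hd : (((4 * d : ℤ)) : ℚ) ≠ 0 := by
    have := hsq.ne_zero; exact_mod_cast (show (4 * d : ℤ) ≠ 0 by omega)
  haveI := cm7.isElliptic_quadraticTwist hd
  obtain ⟨C', hC'⟩ := exists_smul_eq_cellModel_baseChange W hC
  rw [cellModel_baseChange] at hC'
  have h := torsionOrder_variableChange_holds W C'
  unfold torsionOrder_variableChange at h
  rw [hC'] at h
  rw [← h]
  exact torsionOrder_cellTwist_of_dvd hsq hd4 h7

/-- **`#W(ℚ)_tors = 2` FOR EVERY MODEL `W` of `cm7^{(d)}`, EVERY squarefree `d ≢ 1 (mod 4)`** (no condition at `7`: c301's theorem for `7 ∤ d`,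
the previous one for `7 ∣ d`). [cite: Olson1974, Thm. 1 (j = −3375)] [cite: SilvermanAEC2009, VIII.7] -/
theorem torsionOrder_eq_two_of_smul_eq_cm7_quadraticTwist' (hsq : Squarefree d) (hd4 : d % 4 ≠ 1)
    (W : WeierstrassCurve ℚ) [W.IsElliptic] (C : VariableChange ℚ) (hC : C • W = cm7.quadraticTwist (d : ℚ)) :
    W.torsionOrder = 2 := by
  by_cases h7 : (7 : ℤ) ∣ d
  · exact torsionOrder_eq_two_of_smul_eq_cm7_quadraticTwist_of_dvd hsq hd4 h7 W C hC
  · exact torsionOrder_eq_two_of_smul_eq_cm7_quadraticTwist hsq hd4 h7 W C hC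

end Torsion

end Summit.BirchSwinnertonDyer.BirchSwinnertonDyer.Theorems.PrintCf2.TamagawaPlaces

end
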